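import Summits.CriticalPhenomena.PercolationContinuityZ3.Theorems.PercNearOneGluingNoHeavyLowerTailMLnaCex

/-!
# `NoHeavyLowerTail` (crux stmt-CriticalPhenomena-4575): two more CLOSED DOORS of the witness-designation
# family — "cousin (ii)" is FALSE and a COMMON CIL WITNESS across a non-observer bond NEED NOT EXIST (six vertices)

Companion of `PercNearOneGluingNoHeavyLowerTailMLnaCex.lean` (`not_MLna`).  Coordinator ruling 2026-08-18/19
(ttrl2 engine census `run/shared/lean/ttrl/mlna/README.md`, RESULT (3)–(4) and `COUSIN2.md`): the whole
WITNESS-DESIGNATION family of inductions for the cumulative isolation lemma — a rule that picks a relay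
(typically a champion) and asks it to remain a CIL witness after deleting / contracting a bond — is dropped;
this file records the two remaining smallest exact witnesses as kernel-checked theorems.

Setting (as in `…MLnaCex`): `μ_w = prodBernoulli w` on `Fin n`, relays `A`, level `j`, observer `o ∉ A`,
`N_o = |{a ∈ A : o ↔ a}|`, `bad_w(o) = μ_w(1 ≤ N_o ≤ j)`, lightness `I_w(x) = μ_w(|π(x)| ≤ j)`
(`π(x) = {a ∈ A : x ↔ a}`, so a relay counts itself); a CIL WITNESS at `o` is a relay `x` with
`bad_w(o) ≤ I_w(x)`; a CHAMPION is a maximiser of `I_w` on `A`.  For a pair `e = s(u, z)` of two non-relay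
vertices other than `o` with `0 < w(e) < 1`: `w[e ↦ 0]` ("`G ∖ e`", deletion) and `w[e ↦ 1]` ("`G / e`",
gluing) — `Function.update w e 0 / 1`.

* **cousin (ii)** (prim-gen-induct gen 2, census ASK (3)): every champion of `G ∖ e` is a CIL witness at `o`
  in `G / e`.  FALSE (`not_cousin2_six`, `not_cousin2`): `n = 6`, `A = {0,1,2}`, `j = 1`, pairs
  `0–5, 1–4, 2–3` of weight `19/20`, `3–4` of weight `1/20`, `e = 3–5` of weight `19/20`, `o = 4`:
  in `G ∖ e` the relay `0` is cut off (`I(0) = 1`, the unique champion; `I(1) = I(2) = 7639/8000`), while in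
  `G / e` one has `I(0) = 15239/160000 ≈ 0.0952 < bad(4) = 144457/160000 ≈ 0.9029`.  (Smallest
  unique-champion failure of the exhaustive census; 0.32 % of 23.9 M exact `(o, e)` checks fail, every
  failure is a champion SWITCH between `G ∖ e` and `G / e`.)
* **no common witness** (`noCommonWitness_six`, `not_commonWitness`): `n = 6`, `A = {0,1,2}`, `j = 1`, pairs
  `0–1 13/20 · 0–4 3/5 · 0–5 1/20 · 1–5 9/10 · 2–3 19/20 · 2–4 4/5`, `e = 3–5` of weight `9/10`, `o = 4`:
  CIL holds at `o` in `G`, in `G ∖ e` (witness `2` only) and in `G / e` (witness `0` only), but NO relay is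
  a witness on both sides: `I_{G∖e}(0) = 17381/10⁵ < bad_{G∖e}(4) = 36011/10⁵ > I_{G∖e}(1) = 1337/4000`,
  `I_{G/e}(2) = 7293/10⁵ < bad_{G/e}(4) = 169581/2·10⁶` (exact `D = 23721/2000000`, the `n = 6` case of
  RESULT (4a); under optimisation `sup D ≈ 0.09`, attained when `u, z` are ports of two different relays,
  i.e. `e` is a relay–relay bond in disguise).  Hence no induction over a non-observer bond can designate
  ONE relay to serve both minors — only per-configuration witnesses or observer-edge steps remain.

The cumulative isolation lemma and the crux are NOT refuted (CIL holds at every vertex of both witnesses).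

Contents: the event `{1 ≤ N_o ≤ 1}` as a `Bool` test / exact count (`badB`, `cntBad`, `real_bad`; the
lightness side `lightB`/`cntI`/`real_light` is imported from `…MLnaCex{,Checker}`), the two witness families
`cA q`, `cB q` (`q` = the weight of `e = 3–5`, listed FIRST so that deletion / gluing is `q ↦ 0 / 1`:
`update_wOfList_cons`), the arithmetic by KERNEL reduction (`decide +kernel` over `2⁵` resp. `2⁷`
configurations, standard axioms, no `native_decide`), and the four deliverables.  No sorries; the `def`s are
computable checkers and witness data only.
-/

namespace Summit.CriticalPhenomena.PercolationContinuityZ3.Theorems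

open MeasureTheory
open Literature.Probability.LatticeModels Literature.Probability.Percolation
open Summit.CriticalPhenomena.PercolationContinuityZ3.Theorems.AdditiveGluing.Negative.Cert
open Summit.CriticalPhenomena.PercolationContinuityZ3.Theorems.WorstPairExchangeCex (real_eq_wcount)
open MLnaCex

namespace CousinCex

/-! ### The event `{1 ≤ N_o ≤ 1}` as a `Bool` test and an exact count -/

/-- `1 ≤ N_o ≤ 1` (exactly one of the relays `0,1,2` is joined to `o`) on a reach table. -/
def badB (tb : List ℕ) (o : Fin 6) : Bool := decide (1 ≤ nrel tb o ∧ nrel tb o ≤ 1)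

/-- Exact count of `{1 ≤ N_o ≤ 1}` for a weighted edge list on `Fin 6`. -/
def cntBad (l : List (Fin 6 × Fin 6 × ℚ)) (o : Fin 6) : ℚ :=
  ((wtabs 6 l).map fun t => if badB t.1 o then t.2 else 0).sum

/-! ### The two witness families (`q` = weight of the pair `3–5`, listed first) -/

/-- Witness A (cousin (ii)): pairs `3–5 q · 0–5 19/20 · 1–4 19/20 · 2–3 19/20 · 3–4 1/20`. -/
def cA (q : ℚ) : List (Fin 6 × Fin 6 × ℚ) :=
  [(3, 5, q), (0, 5, 19/20), (1, 4, 19/20), (2, 3, 19/20), (3, 4, 1/20)]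

/-- Witness B (no common witness): pairs `3–5 q · 0–1 13/20 · 0–4 3/5 · 0–5 1/20 · 1–5 9/10 · 2–3 19/20 ·
2–4 4/5`. -/
def cB (q : ℚ) : List (Fin 6 × Fin 6 × ℚ) :=
  [(3, 5, q), (0, 1, 13/20), (0, 4, 3/5), (0, 5, 1/20), (1, 5, 9/10), (2, 3, 19/20), (2, 4, 4/5)]

/-- The listed pairs of witness A are distinct. [this file] -/
theorem cA_nodup (q : ℚ) : (wPairs (cA q)).Nodup := by
  have h : wPairs (cA q) = wPairs (cA 0) := rfl
  rw [h]; decide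

/-- The listed pairs of witness B are distinct. [this file] -/
theorem cB_nodup (q : ℚ) : (wPairs (cB q)).Nodup := by
  have h : wPairs (cB q) = wPairs (cB 0) := rfl
  rw [h]; decide

/-- The weights of witness A lie in `[0, 1]` when `q` does. [this file] -/
theorem cA_weights (q : ℚ) (hq : 0 ≤ q ∧ q ≤ 1) : ∀ e ∈ cA q, 0 ≤ e.2.2 ∧ e.2.2 ≤ 1 := by
  intro e he
  simp only [cA, List.mem_cons, List.not_mem_nil, or_false] at he
  rcases he with rfl | rfl | rfl | rfl | rfl
  · exact hq
  all_goals norm_num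

/-- The weights of witness B lie in `[0, 1]` when `q` does. [this file] -/
theorem cB_weights (q : ℚ) (hq : 0 ≤ q ∧ q ≤ 1) : ∀ e ∈ cB q, 0 ≤ e.2.2 ∧ e.2.2 ≤ 1 := by
  intro e he
  simp only [cB, List.mem_cons, List.not_mem_nil, or_false] at he
  rcases he with rfl | rfl | rfl | rfl | rfl | rfl | rfl
  · exact hq
  all_goals norm_num

/-! ### Deleting / gluing the first listed pair -/

/-- `projIcc` of the rational `0` is `0 ∈ [0,1]`. [this file] -/
theorem projIcc_ratCast_zero : Set.projIcc (0 : ℝ) 1 zero_le_one ((0 : ℚ) : ℝ) = 0 := by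
  ext; simp [Set.projIcc]

/-- `projIcc` of the rational `1` is `1 ∈ [0,1]`. [this file] -/
theorem projIcc_ratCast_one : Set.projIcc (0 : ℝ) 1 zero_le_one ((1 : ℚ) : ℝ) = 1 := by
  ext; simp [Set.projIcc]

/-- Updating the weight of the FIRST listed pair replaces its listed weight. [this file] -/
theorem update_wOfList_cons {n : ℕ} (a b : Fin n) (q q' : ℚ) (rest : List (Fin n × Fin n × ℚ)) :
    Function.update (wOfList ((a, b, q) :: rest)) s(a, b) (Set.projIcc (0 : ℝ) 1 zero_le_one (q' : ℝ)) =
      wOfList ((a, b, q') :: rest) := by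
  funext x
  by_cases hx : x = s(a, b)
  · subst hx
    rw [Function.update_self]
    simp [wOfList, mkE]
  · rw [Function.update_of_ne hx]
    simp [wOfList, mkE, hx]

/-- Deleting the first listed pair: `w[s(a,b) ↦ 0]`. [this file] -/
theorem update_wOfList_cons_zero {n : ℕ} (a b : Fin n) (q : ℚ) (rest : List (Fin n × Fin n × ℚ)) :
    Function.update (wOfList ((a, b, q) :: rest)) s(a, b) 0 = wOfList ((a, b, 0) :: rest) := by
  rw [← update_wOfList_cons a b q 0 rest, projIcc_ratCast_zero]

/-- Gluing the first listed pair: `w[s(a,b) ↦ 1]`. [this file] -/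
theorem update_wOfList_cons_one {n : ℕ} (a b : Fin n) (q : ℚ) (rest : List (Fin n × Fin n × ℚ)) :
    Function.update (wOfList ((a, b, q) :: rest)) s(a, b) 1 = wOfList ((a, b, 1) :: rest) := by
  rw [← update_wOfList_cons a b q 1 rest, projIcc_ratCast_one]

/-- The weight of the first listed pair lies strictly between `0` and `1` when `0 < q < 1`. [this file] -/
theorem wOfList_cons_pos_lt_one {n : ℕ} (a b : Fin n) (q : ℚ) (hq0 : 0 < q) (hq1 : q < 1)
    (rest : List (Fin n × Fin n × ℚ)) :
    0 < wOfList ((a, b, q) :: rest) s(a, b) ∧ wOfList ((a, b, q) :: rest) s(a, b) < 1 := by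
  have h : wOfList ((a, b, q) :: rest) s(a, b) = Set.projIcc (0 : ℝ) 1 zero_le_one (q : ℝ) := by
    simp [wOfList, mkE]
  rw [h]
  constructor
  · rw [← Subtype.coe_lt_coe]
    simp only [Set.projIcc]
    have : (0 : ℝ) < min 1 (q : ℝ) := lt_min one_pos (by exact_mod_cast hq0)
    simpa using this
  · rw [← Subtype.coe_lt_coe]
    simp only [Set.projIcc]
    have h1 : min 1 (q : ℝ) < 1 := min_lt_iff.2 (Or.inr (by exact_mod_cast hq1))
    have h2 : max 0 (min 1 (q : ℝ)) < 1 := max_lt one_pos h1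
    simpa using h2

/-! ### The arithmetic (exact rational counts, kernel reduction) -/

/-- Witness A: in `G ∖ e` the relay `0` is a champion (`I(1) ≤ I(0)`, `I(2) ≤ I(0)`), and in `G / e` it is
NOT a CIL witness at `o = 4` (`I(0) < bad(4)`). [this file] -/
theorem facts_A : cntI (cA 0) 1 ≤ cntI (cA 0) 0 ∧ cntI (cA 0) 2 ≤ cntI (cA 0) 0 ∧
    cntI (cA 1) 0 < cntBad (cA 1) 4 := by
  decide +kernel

/-- Witness B, deletion side: `0` and `1` are not CIL witnesses at `o = 4` in `G ∖ e`, `2` is. [this file] -/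
theorem facts_B_del : cntI (cB 0) 0 < cntBad (cB 0) 4 ∧ cntI (cB 0) 1 < cntBad (cB 0) 4 ∧
    cntBad (cB 0) 4 ≤ cntI (cB 0) 2 := by
  decide +kernel

/-- Witness B, glued side: `2` is not a CIL witness at `o = 4` in `G / e`, `0` is. [this file] -/
theorem facts_B_glu : cntI (cB 1) 2 < cntBad (cB 1) 4 ∧ cntBad (cB 1) 4 ≤ cntI (cB 1) 0 := by
  decide +kernel

/-- Witness B itself (`q = 9/10`): `0` is a CIL witness at `o = 4` in `G`. [this file] -/
theorem facts_B_G : cntBad (cB (9/10)) 4 ≤ cntI (cB (9/10)) 0 := by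
  decide +kernel

/-! ### Measure side -/

open scoped Classical

/-- `bad(o) = cntBad`. [this file] -/
theorem real_bad {l : List (Fin 6 × Fin 6 × ℚ)} (hnd : (wPairs l).Nodup)
    (hq : ∀ e ∈ l, 0 ≤ e.2.2 ∧ e.2.2 ≤ 1) (o : Fin 6) :
    (prodBernoulli (wOfList l)).real
        {ω : BondConfig (Fin 6) |
          1 ≤ (({0, 1, 2} : Finset (Fin 6)).filter fun z => ω ∈ openConn o z).card ∧
          (({0, 1, 2} : Finset (Fin 6)).filter fun z => ω ∈ openConn o z).card ≤ 1} = (cntBad l o : ℝ) := by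
  refine real_eq_wcount hnd hq (fun tb => badB tb o) _ fun ω => ?_
  simp only [badB, decide_eq_true_eq, Set.mem_setOf_eq, nrel_reachTable]

end CousinCex

open CousinCex
open scoped Classical

/-- **Cousin (ii) fails on six vertices.**  For `n = 6`, relays `A = {0, 1, 2}` and level `j = 1` it is NOT
true that for every weight `w`, every non-relay observer `o` and every pair `e = s(u, z)` of two further
non-relay vertices with `0 < w(e) < 1`, every champion of `w[e ↦ 0]` is a CIL witness at `o` under
`w[e ↦ 1]`: witness A (`o = 4`, `e = s(3, 5)`, champion `0` of the deletion). [this file] -/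
theorem not_cousin2_six :
    ¬ (∀ (w : Sym2 (Fin 6) → unitInterval) (o u z c : Fin 6),
      o ∉ ({0, 1, 2} : Finset (Fin 6)) → u ∉ ({0, 1, 2} : Finset (Fin 6)) → z ∉ ({0, 1, 2} : Finset (Fin 6)) →
      o ≠ u → o ≠ z → u ≠ z → 0 < w s(u, z) → w s(u, z) < 1 → c ∈ ({0, 1, 2} : Finset (Fin 6)) →
      (∀ a ∈ ({0, 1, 2} : Finset (Fin 6)),
        (prodBernoulli (Function.update w s(u, z) 0)).real {ω : BondConfig (Fin 6) |
            (({0, 1, 2} : Finset (Fin 6)).filter fun y => ω ∈ openConn a y).card ≤ 1} ≤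
          (prodBernoulli (Function.update w s(u, z) 0)).real {ω : BondConfig (Fin 6) |
            (({0, 1, 2} : Finset (Fin 6)).filter fun y => ω ∈ openConn c y).card ≤ 1}) →
      (prodBernoulli (Function.update w s(u, z) 1)).real {ω : BondConfig (Fin 6) |
          1 ≤ (({0, 1, 2} : Finset (Fin 6)).filter fun a => ω ∈ openConn o a).card ∧
          (({0, 1, 2} : Finset (Fin 6)).filter fun a => ω ∈ openConn o a).card ≤ 1} ≤
        (prodBernoulli (Function.update w s(u, z) 1)).real {ω : BondConfig (Fin 6) |
          (({0, 1, 2} : Finset (Fin 6)).filter fun y => ω ∈ openConn c y).card ≤ 1}) := by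
  intro h
  obtain ⟨h10, h20, hbad⟩ := facts_A
  have hw := wOfList_cons_pos_lt_one (3 : Fin 6) 5 (19/20) (by norm_num) (by norm_num)
    [(0, 5, 19/20), (1, 4, 19/20), (2, 3, 19/20), (3, 4, 1/20)]
  have hdel := update_wOfList_cons_zero (3 : Fin 6) 5 (19/20)
    [(0, 5, 19/20), (1, 4, 19/20), (2, 3, 19/20), (3, 4, 1/20)]
  have hglu := update_wOfList_cons_one (3 : Fin 6) 5 (19/20)
    [(0, 5, 19/20), (1, 4, 19/20), (2, 3, 19/20), (3, 4, 1/20)]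
  have hchamp : ∀ a ∈ ({0, 1, 2} : Finset (Fin 6)),
      (prodBernoulli (Function.update (wOfList (cA (19/20))) s(3, 5) 0)).real {ω : BondConfig (Fin 6) |
          (({0, 1, 2} : Finset (Fin 6)).filter fun y => ω ∈ openConn a y).card ≤ 1} ≤
        (prodBernoulli (Function.update (wOfList (cA (19/20))) s(3, 5) 0)).real {ω : BondConfig (Fin 6) |
          (({0, 1, 2} : Finset (Fin 6)).filter fun y => ω ∈ openConn (0 : Fin 6) y).card ≤ 1} := by
    intro a ha
    rw [cA, hdel]
    have hnd := cA_nodup 0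
    have hq := cA_weights 0 ⟨le_rfl, zero_le_one⟩
    simp only [Finset.mem_insert, Finset.mem_singleton] at ha
    rcases ha with rfl | rfl | rfl
    · exact le_rfl
    · rw [← cA, real_light hnd hq, real_light hnd hq]; exact_mod_cast h10
    · rw [← cA, real_light hnd hq, real_light hnd hq]; exact_mod_cast h20
  have hc := h (wOfList (cA (19/20))) 4 3 5 0 (by decide) (by decide) (by decide) (by decide) (by decide)
    (by decide) hw.1 hw.2 (by decide) hchamp
  rw [cA, hglu, ← cA, real_bad (cA_nodup 1) (cA_weights 1 ⟨zero_le_one, le_rfl⟩),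
    real_light (cA_nodup 1) (cA_weights 1 ⟨zero_le_one, le_rfl⟩)] at hc
  have hc' : cntBad (cA 1) 4 ≤ cntI (cA 1) 0 := by exact_mod_cast hc
  exact absurd hc' (not_le.2 hbad)

/-- **Cousin (ii) is FALSE** ("every champion of `G ∖ e` is a CIL witness at `o` in `G / e`", for a
non-observer pair `e` of non-relay vertices with `0 < w(e) < 1`; ttrl2 census ASK (3), `run/shared/lean/ttrl/mlna/README.md`):
the statement universally quantified over the vertex count `n`, the relay set `A` (with `j + 2 ≤ |A|`) and
the level `j ≥ 1` fails at `n = 6`, `A = {0,1,2}`, `j = 1` (`not_cousin2_six`).  Together with `not_MLna` and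
`not_commonWitness` this closes the witness-designation family of CIL inductions; the cumulative isolation
lemma itself is not refuted. [this file] -/
theorem not_cousin2 :
    ¬ (∀ (n : ℕ) (A : Finset (Fin n)) (j : ℕ) (w : Sym2 (Fin n) → unitInterval) (o u z c : Fin n),
      1 ≤ j → j + 2 ≤ A.card → o ∉ A → u ∉ A → z ∉ A → o ≠ u → o ≠ z → u ≠ z →
      0 < w s(u, z) → w s(u, z) < 1 → c ∈ A →
      (∀ a ∈ A,
        (prodBernoulli (Function.update w s(u, z) 0)).real {ω : BondConfig (Fin n) |
            (A.filter fun y => ω ∈ openConn a y).card ≤ j} ≤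
          (prodBernoulli (Function.update w s(u, z) 0)).real {ω : BondConfig (Fin n) |
            (A.filter fun y => ω ∈ openConn c y).card ≤ j}) →
      (prodBernoulli (Function.update w s(u, z) 1)).real {ω : BondConfig (Fin n) |
          1 ≤ (A.filter fun a => ω ∈ openConn o a).card ∧ (A.filter fun a => ω ∈ openConn o a).card ≤ j} ≤
        (prodBernoulli (Function.update w s(u, z) 1)).real {ω : BondConfig (Fin n) |
          (A.filter fun y => ω ∈ openConn c y).card ≤ j}) := by
  intro h
  exact not_cousin2_six fun w o u z c => h 6 {0, 1, 2} 1 w o u z c le_rfl (by decide)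

/-- **No common CIL witness across a non-observer bond (six vertices).**  For `n = 6`, `A = {0,1,2}`,
`j = 1` there are a weight `w`, a non-relay observer `o` and a pair `e = s(u, z)` of two further non-relay
vertices with `0 < w(e) < 1` such that CIL holds at `o` under `w`, under `w[e ↦ 0]` and under `w[e ↦ 1]`,
but NO relay is a CIL witness at `o` under both `w[e ↦ 0]` and `w[e ↦ 1]` (witness B: `o = 4`,
`e = s(3, 5)`; exact defect `D = 23721/2000000`). [this file] -/
theorem noCommonWitness_six : ∃ (w : Sym2 (Fin 6) → unitInterval) (o u z : Fin 6),
    o ∉ ({0, 1, 2} : Finset (Fin 6)) ∧ u ∉ ({0, 1, 2} : Finset (Fin 6)) ∧ z ∉ ({0, 1, 2} : Finset (Fin 6)) ∧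
    o ≠ u ∧ o ≠ z ∧ u ≠ z ∧ 0 < w s(u, z) ∧ w s(u, z) < 1 ∧
    (∃ x ∈ ({0, 1, 2} : Finset (Fin 6)),
      (prodBernoulli w).real {ω : BondConfig (Fin 6) |
          1 ≤ (({0, 1, 2} : Finset (Fin 6)).filter fun a => ω ∈ openConn o a).card ∧
          (({0, 1, 2} : Finset (Fin 6)).filter fun a => ω ∈ openConn o a).card ≤ 1} ≤
        (prodBernoulli w).real {ω : BondConfig (Fin 6) |
          (({0, 1, 2} : Finset (Fin 6)).filter fun y => ω ∈ openConn x y).card ≤ 1}) ∧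
    (∃ x ∈ ({0, 1, 2} : Finset (Fin 6)),
      (prodBernoulli (Function.update w s(u, z) 0)).real {ω : BondConfig (Fin 6) |
          1 ≤ (({0, 1, 2} : Finset (Fin 6)).filter fun a => ω ∈ openConn o a).card ∧
          (({0, 1, 2} : Finset (Fin 6)).filter fun a => ω ∈ openConn o a).card ≤ 1} ≤
        (prodBernoulli (Function.update w s(u, z) 0)).real {ω : BondConfig (Fin 6) |
          (({0, 1, 2} : Finset (Fin 6)).filter fun y => ω ∈ openConn x y).card ≤ 1}) ∧
    (∃ x ∈ ({0, 1, 2} : Finset (Fin 6)),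
      (prodBernoulli (Function.update w s(u, z) 1)).real {ω : BondConfig (Fin 6) |
          1 ≤ (({0, 1, 2} : Finset (Fin 6)).filter fun a => ω ∈ openConn o a).card ∧
          (({0, 1, 2} : Finset (Fin 6)).filter fun a => ω ∈ openConn o a).card ≤ 1} ≤
        (prodBernoulli (Function.update w s(u, z) 1)).real {ω : BondConfig (Fin 6) |
          (({0, 1, 2} : Finset (Fin 6)).filter fun y => ω ∈ openConn x y).card ≤ 1}) ∧
    ∀ x ∈ ({0, 1, 2} : Finset (Fin 6)),
      (prodBernoulli (Function.update w s(u, z) 0)).real {ω : BondConfig (Fin 6) |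
          (({0, 1, 2} : Finset (Fin 6)).filter fun y => ω ∈ openConn x y).card ≤ 1} <
        (prodBernoulli (Function.update w s(u, z) 0)).real {ω : BondConfig (Fin 6) |
          1 ≤ (({0, 1, 2} : Finset (Fin 6)).filter fun a => ω ∈ openConn o a).card ∧
          (({0, 1, 2} : Finset (Fin 6)).filter fun a => ω ∈ openConn o a).card ≤ 1} ∨
      (prodBernoulli (Function.update w s(u, z) 1)).real {ω : BondConfig (Fin 6) |
          (({0, 1, 2} : Finset (Fin 6)).filter fun y => ω ∈ openConn x y).card ≤ 1} <
        (prodBernoulli (Function.update w s(u, z) 1)).real {ω : BondConfig (Fin 6) |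
          1 ≤ (({0, 1, 2} : Finset (Fin 6)).filter fun a => ω ∈ openConn o a).card ∧
          (({0, 1, 2} : Finset (Fin 6)).filter fun a => ω ∈ openConn o a).card ≤ 1} := by
  obtain ⟨hd0, hd1, hd2⟩ := facts_B_del
  obtain ⟨hg2, hg0⟩ := facts_B_glu
  have hG := facts_B_G
  have hw := wOfList_cons_pos_lt_one (3 : Fin 6) 5 (9/10) (by norm_num) (by norm_num)
    [(0, 1, 13/20), (0, 4, 3/5), (0, 5, 1/20), (1, 5, 9/10), (2, 3, 19/20), (2, 4, 4/5)]
  have hdel := update_wOfList_cons_zero (3 : Fin 6) 5 (9/10)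
    [(0, 1, 13/20), (0, 4, 3/5), (0, 5, 1/20), (1, 5, 9/10), (2, 3, 19/20), (2, 4, 4/5)]
  have hglu := update_wOfList_cons_one (3 : Fin 6) 5 (9/10)
    [(0, 1, 13/20), (0, 4, 3/5), (0, 5, 1/20), (1, 5, 9/10), (2, 3, 19/20), (2, 4, 4/5)]
  have hq9 : (0 : ℚ) ≤ 9/10 ∧ (9/10 : ℚ) ≤ 1 := by norm_num
  refine ⟨wOfList (cB (9/10)), 4, 3, 5, by decide, by decide, by decide, by decide, by decide, by decide,
    hw.1, hw.2, ⟨0, by simp, ?_⟩, ⟨2, by simp, ?_⟩, ⟨0, by simp, ?_⟩, ?_⟩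
  · rw [real_bad (cB_nodup _) (cB_weights _ hq9), real_light (cB_nodup _) (cB_weights _ hq9)]
    exact_mod_cast hG
  · rw [cB, hdel, ← cB, real_bad (cB_nodup 0) (cB_weights 0 ⟨le_rfl, zero_le_one⟩),
      real_light (cB_nodup 0) (cB_weights 0 ⟨le_rfl, zero_le_one⟩)]
    exact_mod_cast hd2
  · rw [cB, hglu, ← cB, real_bad (cB_nodup 1) (cB_weights 1 ⟨zero_le_one, le_rfl⟩),
      real_light (cB_nodup 1) (cB_weights 1 ⟨zero_le_one, le_rfl⟩)]
    exact_mod_cast hg0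
  · intro x hx
    rw [cB, hdel, hglu, ← cB, ← cB, real_bad (cB_nodup 0) (cB_weights 0 ⟨le_rfl, zero_le_one⟩),
      real_light (cB_nodup 0) (cB_weights 0 ⟨le_rfl, zero_le_one⟩),
      real_bad (cB_nodup 1) (cB_weights 1 ⟨zero_le_one, le_rfl⟩),
      real_light (cB_nodup 1) (cB_weights 1 ⟨zero_le_one, le_rfl⟩)]
    simp only [Finset.mem_insert, Finset.mem_singleton] at hx
    rcases hx with rfl | rfl | rfl
    · exact Or.inl (by exact_mod_cast hd0)
    · exact Or.inl (by exact_mod_cast hd1)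
    · exact Or.inr (by exact_mod_cast hg2)

/-- **A common CIL witness across a non-observer bond need not exist.**  It is NOT true that for all
`n`, relays `A` (`j + 2 ≤ |A|`), levels `j ≥ 1`, weights `w`, non-relay observers `o` and pairs `e = s(u, z)`
of two further non-relay vertices with `0 < w(e) < 1`, CIL at `o` under `w`, `w[e ↦ 0]` and `w[e ↦ 1]`
implies that SOME relay is a CIL witness at `o` under both `w[e ↦ 0]` and `w[e ↦ 1]`
(`noCommonWitness_six`).  Consequence (ttrl2 RESULT (4)): no fixed designation rule can drive a
witness-edge induction over non-observer bonds. [this file] -/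
theorem not_commonWitness :
    ¬ (∀ (n : ℕ) (A : Finset (Fin n)) (j : ℕ) (w : Sym2 (Fin n) → unitInterval) (o u z : Fin n),
      1 ≤ j → j + 2 ≤ A.card → o ∉ A → u ∉ A → z ∉ A → o ≠ u → o ≠ z → u ≠ z →
      0 < w s(u, z) → w s(u, z) < 1 →
      (∃ x ∈ A, (prodBernoulli w).real {ω : BondConfig (Fin n) |
            1 ≤ (A.filter fun a => ω ∈ openConn o a).card ∧ (A.filter fun a => ω ∈ openConn o a).card ≤ j} ≤
          (prodBernoulli w).real {ω : BondConfig (Fin n) | (A.filter fun y => ω ∈ openConn x y).card ≤ j}) →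
      (∃ x ∈ A, (prodBernoulli (Function.update w s(u, z) 0)).real {ω : BondConfig (Fin n) |
            1 ≤ (A.filter fun a => ω ∈ openConn o a).card ∧ (A.filter fun a => ω ∈ openConn o a).card ≤ j} ≤
          (prodBernoulli (Function.update w s(u, z) 0)).real {ω : BondConfig (Fin n) |
            (A.filter fun y => ω ∈ openConn x y).card ≤ j}) →
      (∃ x ∈ A, (prodBernoulli (Function.update w s(u, z) 1)).real {ω : BondConfig (Fin n) |
            1 ≤ (A.filter fun a => ω ∈ openConn o a).card ∧ (A.filter fun a => ω ∈ openConn o a).card ≤ j} ≤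
          (prodBernoulli (Function.update w s(u, z) 1)).real {ω : BondConfig (Fin n) |
            (A.filter fun y => ω ∈ openConn x y).card ≤ j}) →
      ∃ x ∈ A,
        (prodBernoulli (Function.update w s(u, z) 0)).real {ω : BondConfig (Fin n) |
            1 ≤ (A.filter fun a => ω ∈ openConn o a).card ∧ (A.filter fun a => ω ∈ openConn o a).card ≤ j} ≤
          (prodBernoulli (Function.update w s(u, z) 0)).real {ω : BondConfig (Fin n) |
            (A.filter fun y => ω ∈ openConn x y).card ≤ j} ∧
        (prodBernoulli (Function.update w s(u, z) 1)).real {ω : BondConfig (Fin n) |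
            1 ≤ (A.filter fun a => ω ∈ openConn o a).card ∧ (A.filter fun a => ω ∈ openConn o a).card ≤ j} ≤
          (prodBernoulli (Function.update w s(u, z) 1)).real {ω : BondConfig (Fin n) |
            (A.filter fun y => ω ∈ openConn x y).card ≤ j}) := by
  intro h
  obtain ⟨w, o, u, z, ho, hu, hz, hou, hoz, huz, hw0, hw1, hG, hD, hU, hno⟩ := noCommonWitness_six
  obtain ⟨x, hx, hxD, hxU⟩ :=
    h 6 {0, 1, 2} 1 w o u z le_rfl (by decide) ho hu hz hou hoz huz hw0 hw1 hG hD hU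
  rcases hno x hx with hlt | hlt
  · exact absurd hxD (not_le.2 hlt)
  · exact absurd hxU (not_le.2 hlt)

end Summit.CriticalPhenomena.PercolationContinuityZ3.Theorems
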